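/-
Copyright: b2b-lace packet (CARVER gen 55).  [FvdH17] §5.1 "Elements of the bounds" / App. B Table "definition of
`P^{ι,b}(x,y)`" rows `b ≥ 2`: the ENTRY INEQUALITY for the element `(P⃗^ι)_2` over the tree objects `vecPiota`
(`NobleWeightedBlocks`), its landed closed form `NobleBlocks.vecPiota_two` (`NobleElementsClosedFormsRows`),
`Letters.perc` (`NoblePercLetters`), `tauGe` (`NobleBoundsN0`), the landed (5.40) bubble-slot passage
`tsum_kdc_perc_B_ge_le_ofReal` (`NobleBubbleLetterSums`) and the landed `(A)_{0,0}` transfer form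
`perc_matA_zero_zero_le_of_sumLE` (`NobleEntryVecPEZero`).  Proofs only; no named fact; no numeral; no dimension.
-/
import Literature.Probability.FitznerVanDerHofstad2017.NobleEntryVecPEZero
import Literature.Probability.FitznerVanDerHofstad2017.NobleBubbleLetterSums
import HarnessLib

/-!
# [FvdH17] §5.1: the entry `(P⃗^ι)_2 ≤ τ̄₃·(P⃗^S)_2 + τ̄₃ + (5.40)_{1,2}(e) + (A)_{0,0}·((5.40)_{1,1}(e) + τ̄₃)`

CITATION HEADER (PLACEMENT v2). This module is part of a certified REPRODUCTION of:
R. Fitzner, R. van der Hofstad, *Mean-field behavior for nearest-neighbor percolation in `d > 10`*,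
Electron. J. Probab. **22** (2017) no. 43 [FvdH17] (extended version arXiv:1506.07977v2), §5.1 "Elements of the
bounds" (arXiv v2 p. 50: `(P⃗^ι)_b = (1/2d)[δ_{0,b} + Σ_{ι,x,y} P^{ι,b}(x,y)]`), App. B Table "Diagrams and definition
of `P^{ι,b}(x,y)`" rows `b ≥ 2` (v2 p. 73: "y on sausage" `τ_{3,p}(e_ι) P^{(0),2}(x−e_ι,y−e_ι)`, "x = e_ι"
`δ_{0,y}τ_{3,p}(e_ι) + 𝓑_{1,2}(y,x)`, "x ≠ e_ι, y not on sausage" `(𝓑_{1,1}(y,e_ι) + δ_{0,y}τ_{3,p}(e_ι))(1−δ_{e_ι,x})P(e_ι ⇔ x)`),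
§6.1 Case `a ≥ 2` (v2 p. 60), §4.2 (4.1), (4.7), (4.14)–(4.16) (pp. 34–36: `τ_{n,p}`, the repulsive bubble and its
product majorant), §5.4 closing paragraph (v2 p. 56); and of
R. Fitzner, R. van der Hofstad, *Generalized approach to the non-backtracking lace expansion*, Probab. Theory Related
Fields **169** (2017) 1041–1119 [NoBLE17], §5.3.2 display (5.40) (PTRF p. 1098: the repulsive bubble summed over its
middle point).  Origin: build `lace` (host summit CriticalPhenomena), CARVER seat; node N76-PIOTA2 of the cell's lemma
DAG (leaf L4 of the REV15 precondition census: the `P⃗^ι` entry producers consumed by the `ι`-families `Ξ^ι`).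

WHAT THIS FILE DOES.  `NobleBlocks.vecPiota_two` is the identity
`(P⃗^ι)_2 = (1/2d) Σ_ι [τ_{(≥3)}(e_ι)·(P⃗^S)_2 + (τ_{(≥3)}(e_ι) + Σ_y 𝓑_{≥1,≥2}(y,e_ι)) + (Σ_x (1−δ_{x,0})P̃(0 ⇔ x))·(Σ_y 𝓑_{≥1,≥1}(y,e_ι) + τ_{(≥3)}(e_ι))]`
for every letter table.  At `L = Letters.perc d p` each `ι`-summand is bounded by the same quantity: `τ_{(≥3)}(e_ι) =
ofReal τ_{3,p}(e₁) ≤ ofReal T3` (`perc_tau_ge`, `tauGe_stepVec`); `(P⃗^S)_2 ≤ W` (a binder: the landed producer is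
`NobleEntryVecPETwo.vecPS_two_le_ofReal`); the two bubble sums at the unit vector lose their `y = 0` term (`τ_{(≥1)}(0) = 0`,
`tauGe_zero_of_ne`, through the product majorant `perc_B_le_Bst`) and are then instances of the landed (5.40) passage
`tsum_kdc_perc_B_ge_le_ofReal` on the endpoint set `range stepVec`; `Σ_x (1−δ_{x,0})P̃(0 ⇔ x) = (A)_{0,0} ≤ ofReal B` for
any genuine `Σ_x 𝓓_{1,1}(x) ≤ B` (`matA_zero_zero`, `perc_matA_zero_zero_le_of_sumLE`).  The factor `1/2d` cancels the
direction sum.  Results: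

* `perc_tsum_B_ge_one_eq_tsum_kdc` — `Σ_y 𝓑_{≥1,j}(y,x) = Σ_y (1−δ_{y,0}) 𝓑_{≥1,j}(y,x)` at the percolation letters;
* `perc_tsum_B_ge_one_stepVec_le_ofReal` — `Σ_y 𝓑_{≥1,≥m₂}(y,e_ι) ≤ ofReal (bubbleSlotR p Γ̄₂ 1 m₂ M N R₁ R₂)` (`m₂ ≤ M`);
* `perc_vecPiota_two_le` — **the entry inequality, `ℝ≥0∞` shape**:
  `vecPiota (Letters.perc d p) 2 ≤ ofReal T3 · W + (ofReal T3 + ofReal S₁₂) + ofReal B · (ofReal S₁₁ + ofReal T3)`,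
  `S₁ⱼ = bubbleSlotR p (nobleSup2 d p) 1 j M N R₁ R₂ⱼ`, for `2 ≤ d`, `p < p_c`, `2 ≤ M`;
* `perc_vecPiota_two_le_ofReal` — the same as ONE `ENNReal.ofReal (T3·W₂ + (T3 + S₁₂) + B·(S₁₁ + T3))` for a real
  majorant `W₂ ≥ 0` of `(P⃗^S)_2` and non-negative kernel constants (the shape consumed by the block-summation majorant).

`T3`, `W₂`, `B`, `N`, `R₁`, `R₂₁`, `R₂₂` stay binders with landed producers (`TwoPointSrwBound.tauGe_le_trailExtraction_srw`,
`NobleEntryVecPETwo.vecPS_two_le_ofReal`, `DoubleConnectionBubbleCell` / `NobleEntryVecPEZero.sumLE_diagD_halfBubblePrintedR`,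
the trail-word counts and `isRemKernelConst_*` of the packet).  Any `d ≥ 2`; nothing landed is modified; no cited
hypothesis — every statement is a kernel-proved inequality between landed definitions.  The authors' notebook computes
this entry as `Bound[Piota,2,s] = G3·PS₂ + G3 + Bubble₄/(2dz) + (G3 + Bubble₃/(2dz))·½Bubble₂` (`Percolation.nb`, the
`P^ι` cell); that identification (in particular of the two unit-vector bubble slots with `Bubble_m/(2dz)`) and every
numerical reading are NOT part of this module.
-/

noncomputable section

namespace Literature.Probability.FitznerVanDerHofstad2017

open MeasureTheory Finset
open scoped BigOperators ENNReal
open Literature.Probability.LatticeModels Literature.Probability.Percolation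
open Literature.Barriers.CriticalPhenomena
open Literature.Probability.FitznerVanDerHofstad2017.NobleBlocks

variable {d : ℕ}

/-! ## A. The two bubble sums at a unit vector -/

/-- At the percolation letters the `y = 0` term of `Σ_y 𝓑_{≥1,j}(y,x)` vanishes (`𝓑 ≤ 𝓑* = τ_{(≥1)}(0)·τ_j(x) = 0`,
`τ_{1,p}(0) = 0`), so the full sum equals the sum with the factor `(1−δ_{y,0})`.
[cite: FitznerVanDerHofstad2017, §4.2 (4.1), (4.7), (4.14)–(4.16) (arXiv:1506.07977v2 pp. 34–36)] -/
theorem perc_tsum_B_ge_one_eq_tsum_kdc (p : unitInterval) (j : LenIdx) (x : Site d) :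
    ∑' y, (Letters.perc d p).B (.ge 1) j y x = ∑' y, kdc y 0 * (Letters.perc d p).B (.ge 1) j y x := by
  refine tsum_congr fun y => ?_
  by_cases hy : y = 0
  · subst hy
    have h0 : (Letters.perc d p).B (.ge 1) j 0 x = 0 := by
      refine le_antisymm ((perc_B_le_Bst (p := p) (.ge 1) j 0 x).trans ?_) bot_le
      rw [Letters.Bst, perc_tau_ge, tauGe_zero_of_ne p one_ne_zero, ENNReal.ofReal_zero, zero_mul]
    simp [kdc, h0]
  · simp [kdc, hy]

/-- **`Σ_y 𝓑_{≥1,≥m₂}(y,e_ι) ≤ (5.40) at (1,m₂) on the unit vectors`**: counts `N` majorising the trail words to every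
`e_ι`, kernel constants on `range stepVec`; `m₂ ≤ M`, `d ≥ 2`, `p < p_c`.
[cite: FitznerVanDerHofstad2016NoBLE, §5.3.2 (5.40) (PTRF 169 (2017) p. 1098)]
[cite: FitznerVanDerHofstad2017, §4.2 (4.16), (4.18) (arXiv:1506.07977v2 p. 36); App. B Table "definition of P^{ι,b}(x,y)" rows b ≥ 2 (p. 73)] -/
theorem perc_tsum_B_ge_one_stepVec_le_ofReal (hd : 2 ≤ d) (p : unitInterval) (hp : p < criticalProbI d)
    {m₂ M : ℕ} (hm : m₂ ≤ M) (ι : Fin d × Bool) {N : ℕ → ℕ}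
    (hN : ∀ L (κ : Fin d × Bool), (trailWordsTo d L (stepVec κ : Site d)).card ≤ N L) {R₁ R₂ : ℝ}
    (hR₁ : IsRemKernelConst d [M] (Set.range fun κ : Fin d × Bool => (stepVec κ : Site d)) R₁)
    (hR₂ : IsRemKernelConst d [M - m₂, m₂] (Set.range fun κ : Fin d × Bool => (stepVec κ : Site d)) R₂) :
    ∑' y, (Letters.perc d p).B (.ge 1) (.ge m₂) y (stepVec ι) ≤
      ENNReal.ofReal (bubbleSlotR p (nobleSup2 d p) 1 m₂ M N R₁ R₂) := by
  rw [perc_tsum_B_ge_one_eq_tsum_kdc]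
  exact tsum_kdc_perc_B_ge_le_ofReal hd p hp hm (Set.mem_range_self ι) (hN · ι) hR₁ hR₂

/-! ## B. The entry inequality for `(P⃗^ι)_2` -/

/-- **`(P⃗^ι)_2 ≤ τ̄₃·W + (τ̄₃ + S₁₂) + B·(S₁₁ + τ̄₃)`, `ℝ≥0∞` shape** at the percolation letters: `τ_{3,p}(e₁) ≤ T3`,
`(P⃗^S)_2 ≤ W`, `Σ_x 𝓓_{1,1}(x) ≤ B` (so `(A)_{0,0} ≤ ofReal B`), `S₁ⱼ = bubbleSlotR p Γ̄₂(p) 1 j M N R₁ R₂ⱼ` the (5.40)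
slots of the two unit-vector bubble sums (`2 ≤ M`, `d ≥ 2`, `p < p_c`).
[cite: FitznerVanDerHofstad2017, §5.1 "Elements of the bounds", `P⃗^ι` (arXiv:1506.07977v2 p. 50); App. B Table "definition of P^{ι,b}(x,y)" rows b ≥ 2 (p. 73); §6.1 Case a ≥ 2 (p. 60)]
[cite: FitznerVanDerHofstad2016NoBLE, §5.3.2 (5.40) (PTRF 169 (2017) p. 1098)] -/
theorem perc_vecPiota_two_le (hd : 2 ≤ d) (p : unitInterval) (hp : p < criticalProbI d) {T3 : ℝ}
    (h3 : tauGe d p 3 (unitSite1 d) ≤ T3) {W : ℝ≥0∞} (hW : vecPS (Letters.perc d p) 2 ≤ W) {B : ℝ}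
    (hB : SumLE (diagD d p 1 1) B) {M : ℕ} (hM : 2 ≤ M) {N : ℕ → ℕ}
    (hN : ∀ L (κ : Fin d × Bool), (trailWordsTo d L (stepVec κ : Site d)).card ≤ N L) {R₁ R₂₁ R₂₂ : ℝ}
    (hR₁ : IsRemKernelConst d [M] (Set.range fun κ : Fin d × Bool => (stepVec κ : Site d)) R₁)
    (hR₂₁ : IsRemKernelConst d [M - 1, 1] (Set.range fun κ : Fin d × Bool => (stepVec κ : Site d)) R₂₁)
    (hR₂₂ : IsRemKernelConst d [M - 2, 2] (Set.range fun κ : Fin d × Bool => (stepVec κ : Site d)) R₂₂) :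
    vecPiota (Letters.perc d p) 2 ≤
      ENNReal.ofReal T3 * W +
        (ENNReal.ofReal T3 + ENNReal.ofReal (bubbleSlotR p (nobleSup2 d p) 1 2 M N R₁ R₂₂)) +
        ENNReal.ofReal B * (ENNReal.ofReal (bubbleSlotR p (nobleSup2 d p) 1 1 M N R₁ R₂₁) + ENNReal.ofReal T3) := by
  have hd1 : 1 ≤ d := by omega
  set L := Letters.perc d p with hL
  set Q : ℝ≥0∞ := ENNReal.ofReal T3 * W +
      (ENNReal.ofReal T3 + ENNReal.ofReal (bubbleSlotR p (nobleSup2 d p) 1 2 M N R₁ R₂₂)) +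
      ENNReal.ofReal B * (ENNReal.ofReal (bubbleSlotR p (nobleSup2 d p) 1 1 M N R₁ R₂₁) + ENNReal.ofReal T3) with hQ
  have hτ : ∀ ι : Fin d × Bool, L.tau (.ge 3) (stepVec ι) ≤ ENNReal.ofReal T3 := fun ι => by
    rw [hL, perc_tau_ge, tauGe_stepVec hd1]
    exact ENNReal.ofReal_le_ofReal h3
  have hA : ∑' x, kdc x 0 * L.pdbc x ≤ ENNReal.ofReal B := by
    rw [← matA_zero_zero]
    exact perc_matA_zero_zero_le_of_sumLE p hB
  have h12 : ∀ ι : Fin d × Bool, ∑' y, L.B (.ge 1) (.ge 2) y (stepVec ι) ≤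
      ENNReal.ofReal (bubbleSlotR p (nobleSup2 d p) 1 2 M N R₁ R₂₂) := fun ι =>
    perc_tsum_B_ge_one_stepVec_le_ofReal hd p hp hM ι hN hR₁ hR₂₂
  have h11 : ∀ ι : Fin d × Bool, ∑' y, L.B (.ge 1) (.ge 1) y (stepVec ι) ≤
      ENNReal.ofReal (bubbleSlotR p (nobleSup2 d p) 1 1 M N R₁ R₂₁) := fun ι =>
    perc_tsum_B_ge_one_stepVec_le_ofReal hd p hp (by omega) ι hN hR₁ hR₂₁
  have hι : ∀ ι : Fin d × Bool,
      L.tau (.ge 3) (stepVec ι) * vecPS L 2 + (L.tau (.ge 3) (stepVec ι) + ∑' y, L.B (.ge 1) (.ge 2) y (stepVec ι)) +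
        (∑' x, kdc x 0 * L.pdbc x) * ((∑' y, L.B (.ge 1) (.ge 1) y (stepVec ι)) + L.tau (.ge 3) (stepVec ι)) ≤ Q :=
    fun ι => add_le_add (add_le_add (mul_le_mul' (hτ ι) hW) (add_le_add (hτ ι) (h12 ι)))
      (mul_le_mul' hA (add_le_add (h11 ι) (hτ ι)))
  have hd0 : (2 : ℝ≥0∞) * (d : ℝ≥0∞) ≠ 0 := by
    have : (d : ℝ≥0∞) ≠ 0 := by exact_mod_cast (show d ≠ 0 by omega)
    exact mul_ne_zero two_ne_zero this
  have hdT : (2 : ℝ≥0∞) * (d : ℝ≥0∞) ≠ ∞ := ENNReal.mul_ne_top ENNReal.ofNat_ne_top (ENNReal.natCast_ne_top d)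
  calc vecPiota L 2
      = invTwoD d * ∑ ι : Fin d × Bool,
          (L.tau (.ge 3) (stepVec ι) * vecPS L 2 +
            (L.tau (.ge 3) (stepVec ι) + ∑' y, L.B (.ge 1) (.ge 2) y (stepVec ι)) +
            (∑' x, kdc x 0 * L.pdbc x) * ((∑' y, L.B (.ge 1) (.ge 1) y (stepVec ι)) + L.tau (.ge 3) (stepVec ι))) :=
        vecPiota_two _
    _ ≤ invTwoD d * ∑ _ι : Fin d × Bool, Q := by gcongr with ι _; exact hι ι
    _ = invTwoD d * (2 * (d : ℝ≥0∞)) * Q := by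
        rw [Finset.sum_const, Finset.card_univ, Fintype.card_prod, Fintype.card_fin, Fintype.card_bool, nsmul_eq_mul]
        push_cast
        ring
    _ = Q := by rw [invTwoD, ENNReal.inv_mul_cancel hd0 hdT, one_mul]

/-- **ENTRY INEQUALITY for `(P⃗^ι)_2`, one `ENNReal.ofReal`**: for a real majorant `0 ≤ W₂` of `(P⃗^S)_2`, a genuine
`Σ_x 𝓓_{1,1}(x) ≤ B`, `τ_{3,p}(e₁) ≤ T3` and non-negative kernel constants,
`vecPiota (Letters.perc d p) 2 ≤ ofReal (T3·W₂ + (T3 + S₁₂) + B·(S₁₁ + T3))` (`2 ≤ M`, `d ≥ 2`, `p < p_c`) — the shape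
consumed by the block-summation majorant (`hPiota : ∀ b, vecPiota … b ≤ ofReal (w b)`).
[cite: FitznerVanDerHofstad2017, §5.1 "Elements of the bounds", `P⃗^ι` (arXiv:1506.07977v2 p. 50); App. B Table "definition of P^{ι,b}(x,y)" rows b ≥ 2 (p. 73); §5.4 closing paragraph (p. 56)]
[cite: FitznerVanDerHofstad2016NoBLE, §5.3.2 (5.40) (PTRF 169 (2017) p. 1098)] -/
theorem perc_vecPiota_two_le_ofReal (hd : 2 ≤ d) (p : unitInterval) (hp : p < criticalProbI d) {T3 : ℝ}
    (h3 : tauGe d p 3 (unitSite1 d) ≤ T3) {W₂ : ℝ} (hW0 : 0 ≤ W₂) (hW : vecPS (Letters.perc d p) 2 ≤ ENNReal.ofReal W₂)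
    {B : ℝ} (hB : SumLE (diagD d p 1 1) B) {M : ℕ} (hM : 2 ≤ M) {N : ℕ → ℕ}
    (hN : ∀ L (κ : Fin d × Bool), (trailWordsTo d L (stepVec κ : Site d)).card ≤ N L) {R₁ R₂₁ R₂₂ : ℝ}
    (hR₁0 : 0 ≤ R₁) (hR₂₁0 : 0 ≤ R₂₁) (hR₂₂0 : 0 ≤ R₂₂)
    (hR₁ : IsRemKernelConst d [M] (Set.range fun κ : Fin d × Bool => (stepVec κ : Site d)) R₁)
    (hR₂₁ : IsRemKernelConst d [M - 1, 1] (Set.range fun κ : Fin d × Bool => (stepVec κ : Site d)) R₂₁)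
    (hR₂₂ : IsRemKernelConst d [M - 2, 2] (Set.range fun κ : Fin d × Bool => (stepVec κ : Site d)) R₂₂) :
    vecPiota (Letters.perc d p) 2 ≤
      ENNReal.ofReal (T3 * W₂ + (T3 + bubbleSlotR p (nobleSup2 d p) 1 2 M N R₁ R₂₂) +
        B * (bubbleSlotR p (nobleSup2 d p) 1 1 M N R₁ R₂₁ + T3)) := by
  have hT3 : 0 ≤ T3 := (tauGe_nonneg p 3 _).trans h3
  have hB0 : 0 ≤ B := (tsum_nonneg fun x => diagD_nonneg p 1 1 x).trans hB.2
  have hS12 : 0 ≤ bubbleSlotR p (nobleSup2 d p) 1 2 M N R₁ R₂₂ :=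
    bubbleSlotR_nonneg p.2.1 (nobleSup2_nonneg' p) 1 2 M N hR₁0 hR₂₂0
  have hS11 : 0 ≤ bubbleSlotR p (nobleSup2 d p) 1 1 M N R₁ R₂₁ :=
    bubbleSlotR_nonneg p.2.1 (nobleSup2_nonneg' p) 1 1 M N hR₁0 hR₂₁0
  refine (perc_vecPiota_two_le hd p hp h3 hW hB hM hN hR₁ hR₂₁ hR₂₂).trans_eq ?_
  rw [ENNReal.ofReal_add (add_nonneg (mul_nonneg hT3 hW0) (add_nonneg hT3 hS12))
      (mul_nonneg hB0 (add_nonneg hS11 hT3)),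
    ENNReal.ofReal_add (mul_nonneg hT3 hW0) (add_nonneg hT3 hS12), ENNReal.ofReal_mul hT3,
    ENNReal.ofReal_add hT3 hS12, ENNReal.ofReal_mul hB0, ENNReal.ofReal_add hS11 hT3]

end Literature.Probability.FitznerVanDerHofstad2017

end
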